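import Summits.CriticalPhenomena.SAWScalingLimit.Theorems.CriticalBubbleBound.Negative.CriticalBubbleBoundOneNumber
import Summits.CriticalPhenomena.SAWScalingLimit.Theorems.CriticalBubbleBound.Negative.CriticalBubbleBoundBubbleConditionFalse

/-!
# `CriticalBubbleBound` ⟺ the WHOLE critical two-point function of `ℤ²` is pointwise finite

Refuter file (cdisprove gen 5, crux item stmt-CriticalPhenomena-7117), supporting lemmas only — no
Theses statement is asserted.

A Simon–Lieb-type ONE-STEP inequality for the full-lattice SAW kernel
`K_x(u,v) = Σ_{γ : u → v SAW of ℤ²} x^{|γ|}` (`latticeKernel`): for lattice neighbours `a ∼ b` and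
every fugacity `x > 0`,

  `K_x(0,b) ≤ K_x(0,a) · (x⁻¹ + K_x(a,b)) = K_x(0,a) · (x⁻¹ + K_x(0,e₀))`

(split a SAW `0 → b` at its visit of `a` if there is one — a pair (SAW `0 → a`, SAW `a → b`) —
and otherwise append the edge `b → a` to get a SAW `0 → a` one step longer). Iterating along any
lattice path from `0`:

  `K_x(0,b) ≤ (x⁻¹ + K_x(0,e₀))^{dist(0,b)}`   UNCONDITIONALLY, for every `b ∈ ℤ²`, every `x > 0`.

Consequences at `x = x_c` (`latticeKernel_criticalFugacity`, i.e. Madras–Slade's `G_{z_c}(0,x)`):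
* `criticalBubbleBound_iff_forall_latticeKernel_ne_top` — the crux (`G_{z_c}(0,e₀) < ∞`, landed
  normal form `criticalBubbleBound_iff_bubble_e₀_ne_top`) is EQUIVALENT to
  `∀ x ∈ ℤ², G_{z_c}(0,x) < ∞`, i.e. verbatim to the open problem as Madras–Slade state it
  ("it has not yet been proved that `G_{z_c}(0,x)` is even finite for `d = 2,3,4`", §1.4):
  finiteness at ONE neighbour site and finiteness at EVERY site are the same statement
  (`criticalBubbleBound_iff_exists_unit_ne_top`; whether finiteness at an arbitrary single site
  `x ≠ 0` already suffices is a comparability question left open here);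
* in the barrier catalogue's vocabulary: `criticalBubbleBound_iff_forall_twoPointENN_lt_top'`.
So the hierarchy of Disproof.lean §3/§6/§15 reads: `Σ_x G = ∞` (proved), `Σ_x G² = ∞` (proved),
`sup_x G < ∞` (open, formally stronger), `∀ x, G(0,x) < ∞` ⟺ `G(0,e₀) < ∞` = THE CRUX.
For the disproof side: a refutation may equally be mounted at ANY fixed site (show
`G_{z_c}(0,x) = ∞` for one `x`), and is no easier there. Companion file
`CriticalBubbleBoundSubharmonic.lean` (last-step decomposition): `K_x(0,b) ≤ x · Σ_{b'∼b} K_x(0,b')`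
for `b ≠ 0` — discrete subharmonicity — so an infinite value at `b ≠ 0` forces an infinite value
at some neighbour of `b`; whether `G_{x_c}(0,e₀) = ∞` would force `G_{x_c}(0,b) = ∞` at EVERY
`b ≠ 0` is a Harnack-type comparability (`c_n(0,b) ≍ c_{n±k}(0,e₀)`, Kesten-pattern territory)
not attempted here.
-/

noncomputable section

open MeasureTheory Filter Topology Set Function
open Literature.Probability.LatticeModels Literature.Probability.Percolation
open Literature.Probability.RandomPlanarGeometry Literature.Probability.RandomPlanarGeometry.SAW
open Literature.Barriers.CriticalPhenomena.SupercriticalSAW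
open scoped ENNReal NNReal BigOperators

namespace Summit.CriticalPhenomena.SAWScalingLimit.Theorems.CriticalBubbleBound.Negative

open Summit.CriticalPhenomena.SAWScalingLimit.Theses.SAWTotalPositivity (CriticalBubbleBound)
open Literature.Barriers.CriticalPhenomena (twoPointENN)

/-! ## Surgery: closing an avoiding walk, splitting a walk through a site -/

/-- SAWs `0 → b` of `ℤ²` that avoid the site `a`. -/
def Avoiding (a b : Site 2) : Set (LatticeSAW 0 b) := {p | a ∉ p.1.support}

/-- Appending the edge `b → a` to a SAW `0 → b` avoiding `a` gives a SAW `0 → a`. [folklore] -/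
def closeAt {a b : Site 2} (h : (zdGraph 2).Adj b a) (p : Avoiding a b) : LatticeSAW 0 a :=
  ⟨p.1.1.concat h, p.1.2.concat p.2 h⟩

/-- The closed walk is one step longer. [folklore] -/
@[simp] theorem length_closeAt {a b : Site 2} (h : (zdGraph 2).Adj b a) (p : Avoiding a b) :
    (closeAt h p).1.length = p.1.1.length + 1 :=
  SimpleGraph.Walk.length_concat _ _

/-- Closing is injective. [folklore] -/
theorem closeAt_injective {a b : Site 2} (h : (zdGraph 2).Adj b a) : Injective (closeAt h) := by
  rintro ⟨⟨p, hp⟩, hpa⟩ ⟨⟨q, hq⟩, hqa⟩ hpq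
  have h1 : p.concat h = q.concat h := congrArg (fun r : LatticeSAW 0 a => r.1) hpq
  obtain ⟨_, h2⟩ := SimpleGraph.Walk.concat_inj h1
  simp only [SimpleGraph.Walk.copy_rfl_rfl] at h2
  subst h2
  rfl

/-- Splitting a SAW `0 → b` at its (unique) visit of `a`: a SAW `0 → a` and a SAW `a → b`. [folklore] -/
def splitAt {a b : Site 2} (p : {p : LatticeSAW 0 b // a ∈ p.1.support}) :
    LatticeSAW 0 a × LatticeSAW a b :=
  (⟨p.1.1.takeUntil a p.2, p.1.2.takeUntil p.2⟩, ⟨p.1.1.dropUntil a p.2, p.1.2.dropUntil p.2⟩)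

/-- Splitting is injective (the two pieces concatenate back to the walk). [folklore] -/
theorem splitAt_injective {a b : Site 2} :
    Injective (splitAt : {p : LatticeSAW 0 b // a ∈ p.1.support} → LatticeSAW 0 a × LatticeSAW a b) := by
  rintro ⟨⟨p, hp⟩, hpa⟩ ⟨⟨q, hq⟩, hqa⟩ hpq
  simp only [splitAt, Prod.mk.injEq, Subtype.mk.injEq] at hpq
  obtain ⟨h1, h2⟩ := hpq
  have : p = q := by
    rw [← p.take_spec hpa, ← q.take_spec hqa, h1, h2]
  subst this
  rfl

/-- The lengths of the two pieces add up. [folklore] -/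
theorem length_splitAt {a b : Site 2} (p : {p : LatticeSAW 0 b // a ∈ p.1.support}) :
    (splitAt p).1.1.length + (splitAt p).2.1.length = p.1.1.length := by
  simp only [splitAt]
  rw [← SimpleGraph.Walk.length_append, SimpleGraph.Walk.take_spec]

/-! ## The one-step inequality -/

/-- **One-step (Simon–Lieb-type) inequality.** For `a ∼ b` and `x > 0`:
`K_x(0,b) ≤ K_x(0,a) · (x⁻¹ + K_x(a,b))`. The SAWs `0 → b` avoiding `a` inject into SAWs
`0 → a` (append the edge `b → a`; weight `x^{|γ|} = x⁻¹ · x^{|γ|+1}`), those through `a` inject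
into pairs (SAW `0 → a`, SAW `a → b`) (weight multiplicative). [folklore] -/
theorem latticeKernel_step {x : ℝ} (hx : 0 < x) {a b : Site 2} (h : (zdGraph 2).Adj a b) :
    latticeKernel x 0 b ≤ latticeKernel x 0 a * (ENNReal.ofReal x⁻¹ + latticeKernel x a b) := by
  classical
  set f : LatticeSAW 0 b → ℝ≥0∞ := fun p => ENNReal.ofReal (x ^ p.1.length) with hf
  have hsplit : latticeKernel x 0 b =
      (∑' p : Avoiding a b, f p) + ∑' p : ((Avoiding a b)ᶜ : Set (LatticeSAW 0 b)), f p := by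
    rw [latticeKernel, tsum_subtype (Avoiding a b) f, tsum_subtype (Avoiding a b)ᶜ f, ← ENNReal.tsum_add]
    refine tsum_congr fun p => ?_
    exact (congrFun (Set.indicator_self_add_compl (Avoiding a b) f) p).symm
  -- walks avoiding `a`
  have h1 : ∑' p : Avoiding a b, f p ≤ ENNReal.ofReal x⁻¹ * latticeKernel x 0 a := by
    have key : ∀ p : Avoiding a b, f p = ENNReal.ofReal x⁻¹ *
        (fun q : LatticeSAW 0 a => ENNReal.ofReal (x ^ q.1.length)) (closeAt h.symm p) := by
      intro p
      simp only [hf, length_closeAt]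
      rw [← ENNReal.ofReal_mul (inv_nonneg.2 hx.le), pow_succ]
      congr 1
      have hx' := hx.ne'
      field_simp
    calc ∑' p : Avoiding a b, f p
        = ∑' p : Avoiding a b, ENNReal.ofReal x⁻¹ *
            (fun q : LatticeSAW 0 a => ENNReal.ofReal (x ^ q.1.length)) (closeAt h.symm p) :=
          tsum_congr key
      _ = ENNReal.ofReal x⁻¹ * ∑' p : Avoiding a b,
            (fun q : LatticeSAW 0 a => ENNReal.ofReal (x ^ q.1.length)) (closeAt h.symm p) :=
          ENNReal.tsum_mul_left
      _ ≤ ENNReal.ofReal x⁻¹ * latticeKernel x 0 a := by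
          rw [latticeKernel]
          exact mul_le_mul' le_rfl (ENNReal.tsum_comp_le_tsum_of_injective (closeAt_injective h.symm) _)
  -- walks through `a`
  have h2 : ∑' p : ((Avoiding a b)ᶜ : Set (LatticeSAW 0 b)), f p ≤
      latticeKernel x 0 a * latticeKernel x a b := by
    have hmem : ∀ p : ((Avoiding a b)ᶜ : Set (LatticeSAW 0 b)), a ∈ p.1.1.support := fun p => by
      have hp := p.2
      simp only [Set.mem_compl_iff, Avoiding, Set.mem_setOf_eq, not_not] at hp
      exact hp
    let S : ((Avoiding a b)ᶜ : Set (LatticeSAW 0 b)) → LatticeSAW 0 a × LatticeSAW a b := fun p =>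
      splitAt ⟨p.1, hmem p⟩
    have hS : Injective S := by
      intro p q hpq
      have h' := splitAt_injective hpq
      have h'' : (p : LatticeSAW 0 b) = q :=
        congrArg (fun r : {p : LatticeSAW 0 b // a ∈ p.1.support} => r.1) h'
      exact Subtype.ext h''
    have key : ∀ p : ((Avoiding a b)ᶜ : Set (LatticeSAW 0 b)), f p =
        (fun qr : LatticeSAW 0 a × LatticeSAW a b =>
          ENNReal.ofReal (x ^ qr.1.1.length) * ENNReal.ofReal (x ^ qr.2.1.length)) (S p) := by
      intro p
      simp only [hf, S]
      rw [← ENNReal.ofReal_mul (pow_nonneg hx.le _), ← pow_add, length_splitAt]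
    calc ∑' p : ((Avoiding a b)ᶜ : Set (LatticeSAW 0 b)), f p
        = ∑' p : ((Avoiding a b)ᶜ : Set (LatticeSAW 0 b)),
            (fun qr : LatticeSAW 0 a × LatticeSAW a b =>
              ENNReal.ofReal (x ^ qr.1.1.length) * ENNReal.ofReal (x ^ qr.2.1.length)) (S p) :=
          tsum_congr key
      _ ≤ ∑' qr : LatticeSAW 0 a × LatticeSAW a b,
            ENNReal.ofReal (x ^ qr.1.1.length) * ENNReal.ofReal (x ^ qr.2.1.length) :=
          ENNReal.tsum_comp_le_tsum_of_injective hS _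
      _ = ∑' (q : LatticeSAW 0 a) (r : LatticeSAW a b),
            ENNReal.ofReal (x ^ q.1.length) * ENNReal.ofReal (x ^ r.1.length) :=
          ENNReal.tsum_prod (f := fun (q : LatticeSAW 0 a) (r : LatticeSAW a b) =>
            ENNReal.ofReal (x ^ q.1.length) * ENNReal.ofReal (x ^ r.1.length))
      _ = latticeKernel x 0 a * latticeKernel x a b := by
          rw [latticeKernel, latticeKernel, ← ENNReal.tsum_mul_right]
          refine tsum_congr fun q => ?_
          rw [ENNReal.tsum_mul_left]
  calc latticeKernel x 0 b = _ := hsplit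
    _ ≤ ENNReal.ofReal x⁻¹ * latticeKernel x 0 a + latticeKernel x 0 a * latticeKernel x a b :=
        add_le_add h1 h2
    _ = latticeKernel x 0 a * (ENNReal.ofReal x⁻¹ + latticeKernel x a b) := by ring

/-! ## Symmetry bookkeeping at a general fugacity -/

/-- `a ∼ b` in `ℤ²` iff `0 ∼ b - a`. [folklore] -/
theorem adj_zero_sub_of_adj {a b : Site 2} (h : (zdGraph 2).Adj a b) : (zdGraph 2).Adj 0 (b - a) := by
  have := (zdGraph_adj_shift_iff (-a) a b).2 h
  simpa [sub_eq_add_neg] using this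

/-- All four nearest-neighbour kernels coincide at every fugacity:
`K_x(0,e) = K_x(0,e₀)` for every unit vector `e` (dihedral symmetry). [folklore] -/
theorem latticeKernel_unit_eq (x : ℝ) {e : Site 2} (he : (zdGraph 2).Adj 0 e) :
    latticeKernel x 0 e = latticeKernel x 0 e₀ := by
  have hneg : ∀ w : Site 2, latticeKernel x 0 (-w) = latticeKernel x 0 w := fun w => by
    have h := latticeKernel_map x negIso 0 w
    simp only [negIso] at h
    exact h
  have hswap : ∀ w : Site 2, latticeKernel x 0 (swapSite w) = latticeKernel x 0 w := fun w => by
    have h := latticeKernel_map x swapIso 0 w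
    have h0 : swapIso 0 = 0 := by funext j; fin_cases j <;> rfl
    rw [h0] at h
    exact h
  have he₁ : swapSite e₀ = Pi.single 1 1 := by
    funext j; fin_cases j <;> simp [swapSite, e₀]
  have he₀ : (Pi.single 0 1 : Site 2) = e₀ := by
    funext j; fin_cases j <;> simp [e₀]
  obtain ⟨i, hi | hi⟩ := (zdGraph_adj_iff _ _).1 he
  · rw [zero_add] at hi; subst hi
    fin_cases i
    · simp [he₀]
    · rw [Fin.mk_one, ← he₁, hswap]
  · have : e = -Pi.single i 1 := eq_neg_of_add_eq_zero_left hi.symm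
    subst this
    rw [hneg]
    fin_cases i
    · simp [he₀]
    · rw [Fin.mk_one, ← he₁, hswap]

/-- The nearest-neighbour kernel between ANY two neighbours is the one number `K_x(0,e₀)`. [folklore] -/
theorem latticeKernel_adj_eq (x : ℝ) {a b : Site 2} (h : (zdGraph 2).Adj a b) :
    latticeKernel x a b = latticeKernel x 0 e₀ := by
  rw [latticeKernel_eq_zero_sub, latticeKernel_unit_eq x (adj_zero_sub_of_adj h)]

/-- The diagonal value: `K_x(u,u) = 1` (only the trivial walk is self-avoiding). [folklore] -/
theorem latticeKernel_self (x : ℝ) (u : Site 2) : latticeKernel x u u = 1 := by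
  have hall : ∀ p : LatticeSAW u u, p = ⟨SimpleGraph.Walk.nil, SimpleGraph.Walk.IsPath.nil⟩ := fun p =>
    Subtype.ext (SimpleGraph.Walk.eq_nil_iff_nil.2 (SimpleGraph.Walk.isPath_iff_nil.1 p.2))
  rw [latticeKernel, tsum_eq_single (⟨SimpleGraph.Walk.nil, SimpleGraph.Walk.IsPath.nil⟩ : LatticeSAW u u)
    (fun p hp => absurd (hall p) hp)]
  simp

/-- The one-step inequality in its one-number, translated form:
`K_x(c,b) ≤ K_x(c,a) · (x⁻¹ + K_x(0,e₀))` for `a ∼ b` and any base point `c`. [folklore] -/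
theorem latticeKernel_step' {x : ℝ} (hx : 0 < x) (c : Site 2) {a b : Site 2} (h : (zdGraph 2).Adj a b) :
    latticeKernel x c b ≤ latticeKernel x c a * (ENNReal.ofReal x⁻¹ + latticeKernel x 0 e₀) := by
  have h' : (zdGraph 2).Adj (a - c) (b - c) := by
    simpa [sub_eq_add_neg] using (zdGraph_adj_shift_iff (-c) a b).2 h
  rw [latticeKernel_eq_zero_sub x c b, latticeKernel_eq_zero_sub x c a, ← latticeKernel_adj_eq x h']
  exact latticeKernel_step hx h'

/-! ## Iteration along lattice paths: an unconditional exponential bound -/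

/-- **Unconditional bound.** For every `x > 0`, all sites `b, c` and every lattice path `q` from `b`
to `c`: `K_x(c,b) ≤ (x⁻¹ + K_x(0,e₀))^{|q|}`. (If `K_x(0,e₀) = ∞` the bound is void; if it is
finite, the whole two-point function is pointwise finite.) [folklore] -/
theorem latticeKernel_le_pow {x : ℝ} (hx : 0 < x) {b c : Site 2} (q : (zdGraph 2).Walk b c) :
    latticeKernel x c b ≤ (ENNReal.ofReal x⁻¹ + latticeKernel x 0 e₀) ^ q.length := by
  induction q with
  | nil => rw [SimpleGraph.Walk.length_nil, pow_zero, latticeKernel_self]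
  | cons hadj q ih =>
    rw [SimpleGraph.Walk.length_cons, pow_succ]
    exact (latticeKernel_step' hx _ hadj.symm).trans (mul_le_mul' ih le_rfl)

/-- The same bound with the graph distance `dist(b,0) = ‖b‖₁` of `ℤ²`. [folklore] -/
theorem latticeKernel_le_pow_dist {x : ℝ} (hx : 0 < x) (b : Site 2) :
    latticeKernel x 0 b ≤ (ENNReal.ofReal x⁻¹ + latticeKernel x 0 e₀) ^ (zdGraph 2).dist b 0 := by
  obtain ⟨q, hq⟩ := ((zdGraph_preconnected_holds (d := 2)) b 0).exists_walk_length_eq_dist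
  rw [← hq]
  exact latticeKernel_le_pow hx q

/-- Pointwise finiteness propagates from the nearest neighbour to every site, at every fugacity. [folklore] -/
theorem latticeKernel_ne_top_of_unit {x : ℝ} (hx : 0 < x) (h : latticeKernel x 0 e₀ ≠ ⊤) (b : Site 2) :
    latticeKernel x 0 b ≠ ⊤ :=
  ne_top_of_le_ne_top
    (ENNReal.pow_ne_top (ENNReal.add_ne_top.2 ⟨ENNReal.ofReal_ne_top, h⟩))
    (latticeKernel_le_pow_dist hx b)

/-! ## The crux ⟺ pointwise finiteness of the whole critical two-point function -/

/-- **`CriticalBubbleBound ⟺ ∀ x ∈ ℤ², G_{x_c}(0,x) < ∞`.** [cite: MadrasSlade1993, §1.4] -/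
theorem criticalBubbleBound_iff_forall_latticeKernel_ne_top :
    CriticalBubbleBound ↔ ∀ b : Site 2, latticeKernel criticalFugacity 0 b ≠ ⊤ := by
  rw [criticalBubbleBound_iff_bubble_e₀_ne_top]
  exact ⟨fun h b => latticeKernel_ne_top_of_unit criticalFugacity_pos_lt_one'.1 h b, fun h => h e₀⟩

/-- … equivalently for ALL pairs of sites (translation invariance). [folklore] -/
theorem criticalBubbleBound_iff_forall_pairs_ne_top :
    CriticalBubbleBound ↔ ∀ u v : Site 2, latticeKernel criticalFugacity u v ≠ ⊤ := by
  rw [criticalBubbleBound_iff_forall_latticeKernel_ne_top]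
  refine ⟨fun h u v => ?_, fun h b => h 0 b⟩
  rw [latticeKernel_eq_zero_sub]; exact h _

/-- … and finiteness at ONE neighbour site already suffices (`∃`-form over the unit vectors;
all four nearest-neighbour kernels coincide, `latticeKernel_unit_eq`). [folklore] -/
theorem criticalBubbleBound_iff_exists_unit_ne_top :
    CriticalBubbleBound ↔ ∃ e : Site 2, (zdGraph 2).Adj 0 e ∧ latticeKernel criticalFugacity 0 e ≠ ⊤ := by
  constructor
  · intro h
    exact ⟨e₀, adj_zero_e₀, criticalBubbleBound_iff_bubble_e₀_ne_top.1 h⟩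
  · rintro ⟨e, he, h⟩
    rw [latticeKernel_unit_eq criticalFugacity he] at h
    exact criticalBubbleBound_iff_bubble_e₀_ne_top.2 h

/-- **Barrier-catalogue form**: the crux is verbatim "`G_{z_c}(x) < ∞` for every `x ∈ ℤ²`"
(Madras–Slade's open problem for `d = 2`, stated for all `x`). [cite: MadrasSlade1993, §1.4] -/
theorem criticalBubbleBound_iff_forall_twoPointENN_lt_top' :
    CriticalBubbleBound ↔ ∀ x : Site 2, twoPointENN 2 (Zd.criticalPoint 2) x < ⊤ := by
  rw [criticalBubbleBound_iff_forall_latticeKernel_ne_top]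
  refine forall_congr' fun b => ?_
  rw [← bubble_eq_twoPointENN, bubble, lt_top_iff_ne_top]

/-- **Quantitative form at `x_c`.** `G_{x_c}(0,b) ≤ (x_c⁻¹ + G_{x_c}(0,e₀))^{‖b‖₁}` for every
`b ∈ ℤ²` — so any admissible crux constant `C` also bounds the whole critical two-point function,
by `(x_c⁻¹ + C)^{‖b‖₁}` (a bound growing exponentially in `‖b‖₁`, against the conjectured DECAY
`|b|^{-5/24}`; nothing better follows from the crux alone by this surgery). [folklore] -/
theorem bubble_le_pow_dist (b : Site 2) :
    latticeKernel criticalFugacity 0 b ≤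
      (ENNReal.ofReal criticalFugacity⁻¹ + bubble e₀) ^ (zdGraph 2).dist b 0 :=
  latticeKernel_le_pow_dist criticalFugacity_pos_lt_one'.1 b

/-- **Disproof side.** `¬ CriticalBubbleBound ⟺ G_{x_c}(0,b) = ∞ for SOME site `b`
`⟺ G_{x_c}(0,e) = ∞` for EVERY unit vector `e`: a refutation may be mounted at any fixed site,
and it always lands on the nearest-neighbour number. [folklore] -/
theorem not_criticalBubbleBound_iff_exists_latticeKernel_eq_top :
    ¬ CriticalBubbleBound ↔ ∃ b : Site 2, latticeKernel criticalFugacity 0 b = ⊤ := by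
  rw [criticalBubbleBound_iff_forall_latticeKernel_ne_top]
  push Not
  rfl

/-- `¬ CriticalBubbleBound ⟺ G_{x_c}(0,e) = ∞` for every unit vector `e`. [folklore] -/
theorem not_criticalBubbleBound_iff_forall_unit_eq_top :
    ¬ CriticalBubbleBound ↔ ∀ e : Site 2, (zdGraph 2).Adj 0 e → latticeKernel criticalFugacity 0 e = ⊤ := by
  rw [criticalBubbleBound_iff_exists_unit_ne_top]
  push Not
  rfl


end Summit.CriticalPhenomena.SAWScalingLimit.Theorems.CriticalBubbleBound.Negative

end
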